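import Summits.QuantumFields.YangMills.Theorems.IR.AfPincerUcXCovSharp
import HarnessLib

/-!
# Crux `IR` (stmt-QuantumFields-19354), line `af-pincer-Uc`, slot «sharp merge I♯_SC» (28967a1bf60ad397):
# the LANE (1)A re-plan against `stub_onsetSharpSC` as NAMED statements — AF window (UV-desk ∕ leg-1 candidate),
# crossover envelope, format-at-scale — with the by-name glue to `SharpOnset.OnsetSharpUKPcSC` and to the route decl,
# and the located strength comparison «format at scale `1/a` ⟺ I♯» (LEAD ym-lead-19354-af-pincer g2, owner R104)

Helper module for item `stmt-QuantumFields-19354` (`--supports stmt-QuantumFields-19354 --as helper`; it closes nothing).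

Owner ruling R104 (ym-beyond-p2 g29, 2026-08-27T13:01:43Z) re-cut the registered slot of crux `IR` to the ONE load-bearing stub
`stub_onsetSharpSC : AfPincerUc.SharpOnset.OnsetSharpUKPcSC` (I♯_SC) plus the residual `stub_irNSC`, and asked the LEAD to re-plan
the supplier lanes AGAINST I♯_SC.  Lane (1)A is the «AF pincer proper»: the X-desk (seat ym-19354-afpincer-s2 g2) proved in
`Theorems/IR/AfPincerUcXCov{,Compact,Pincer,Sharp}` that, per `(G, r)`, ONE scale `ℓ : ℝ → ℝ` carrying
(a) the typical format `TypShellCondUKPc` at a mesh `≤ B(δ)·ℓ(β)` for every budget `δ`, (b) the crossover ENVELOPE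
`|Cov_{β,L}(A_x,A_y)| ≤ W₀ (1+‖x−y‖)⁻⁸` and (c) the asymptotic-freedom WINDOW «`(1+‖x−y‖)⁸ |Cov_{β,L}(A_x,A_y)| ≤ W` on
`T′(W)‖x−y‖ ≤ ℓ(β)`» gives I♯_SC (`AfPincerUc.onsetSharpUKPcSC_of_formatAtScale_covarianceAF`, hypotheses inline).
This file NAMES the three hypotheses so that each desk owes a tree constant, and records what the lane does and does not buy:

* §1 `CovEnvelopeAt G r` (ENVELOPE) and `CovWindowAt G r ℓ` (AF WINDOW at scale `ℓ`) — S2's inline hypotheses verbatim, in the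
  `DlrCollarTransfer.torusE ∕ dens` currency.  The WINDOW is the X-desk's whole debt for compactly supported NT witnesses (R105-compact,
  `afBelowScale_clause_of_covarianceAF_of_compact`) and is a UV-side statement when `ℓ = ℓ_AF(β)` is a scale up to which the
  running coupling stays small: **leg-1 (UV) node candidate «N29»** in the owner's numbering — nothing in the UV leg's present
  currency (`Theses.BalabanUVNodes`, effective actions at the record) states a plaquette-covariance bound; this def is the typed ask.
* §2 `TypFormatAtScaleAt ρ n ε ℓ` — the I-side target of lane (1)A: for every `δ > 0`, the format at a mesh `b ≤ B(δ)·ℓ(β)` for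
  all large `β`.
* §3 `LaneAContractSC` (per simply connected `(G, r)`: admissible `(n, ε)` and ONE `ℓ` with §2 ∧ ENVELOPE ∧ WINDOW) and the glue
  BY NAME: `onsetSharpUKPcSC_of_laneAContractSC : LaneAContractSC → SharpOnset.OnsetSharpUKPcSC` (S2 §7 verbatim),
  `ir_of_laneAContractSC : LaneAContractSC → SharpOnset.IRNSC → Theses.BalabanLadder.IR`.
* §4 THE PIN, by name: ENVELOPE ∧ WINDOW(ℓ) force `a(β)·ℓ(β) < T₀` eventually for EVERY positive unit `a` carrying `LowerBounds G r a`
  (`mul_scale_lt_of_covWindow`; S2's `afBelowScale_of_covarianceAF` + `scale_pinned_of_witness`) — the AF scale is `O(1/a)`.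
* §5 LOCATED STRENGTH COMPARISON (what lane (1)A does NOT buy): at the NT unit itself, format-at-scale IS I♯ —
  `onsetSharpAt_iff_typFormatAtScaleAt_inv` (pointwise, `ℓ = 1/a`, both directions are arithmetic), hence
  `onsetSharpUKPcSC_iff_formatAtInvUnitSC`.  So lane (1)A relocates the X-side to the UV desk (WINDOW) and replaces the NT unit `1/a` by
  the UV scale `ℓ_AF ≤ T₀/a` in the I-side target; it does not lighten the I-side, and `TypFormatAtScaleAt … ℓ_AF` is STRONGER than I♯ at `(G, r, a)`
  unless `ℓ_AF ≳ 1/a` too (a UV∧NT matching statement nobody owes yet).  This is the LEAD's reading for the owner, kernel-checked.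

HONEST FRAMING: named statements and implications among OPEN statements around one open stub of a CONDITIONAL chain
(Track A 0/28 UV); nothing here proves asymptotic freedom, weak-coupling mixing or a gap; not Clay.  No `sorry`;
axioms ⊆ {propext, Classical.choice, Quot.sound}.
-/

set_option autoImplicit false

noncomputable section

open Filter Topology Finset MeasureTheory
open scoped BigOperators SchwartzMap
open Literature.MathematicalPhysics.QuantumFieldTheory hiding ZdEdge
open Literature.MathematicalPhysics.QuantumLattice
open Literature.Probability.LatticeModels (Site box mem_box)
open Summit.QuantumFields.YangMills.Cruxes.OSLegsFromFemtoAndGap.DlrCollarTransfer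
open Summit.QuantumFields.YangMills.Cruxes.IR.AfOnset

namespace Summit.QuantumFields.YangMills.Cruxes.IR.AfPincerUc.SharpLanes

open Summit.QuantumFields.YangMills.Cruxes.IR.AfPincerUc

/-! ## §1 The X ∕ UV side of lane (1)A: crossover envelope and asymptotic-freedom window (S2 g2's hypotheses, named) -/
section XSide

variable (G : Type) [Group G] [TopologicalSpace G] [IsTopologicalGroup G] [CompactSpace G]
  [MeasurableSpace G] [BorelSpace G] (r : LatticeRep G)

/-- **ENVELOPE (crossover envelope of the action-density covariance).**  For all large `β` and all large odd tori `2L+1`: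
`|Cov_{β,L}(A_x, A_y)| ≤ W₀ (1+‖x−y‖)⁻⁸` for all box sites at separation `≤ L` — the hypothesis `henv` of
`AfPincerUc.afBelowScale_of_covarianceAF` verbatim.  Consumed only through the Schwartz TAILS of a non-compact NT witness
(`…XCovCompact` §2); beyond `‖x−y‖ ≳ ℓ log ℓ` it is translation-uniform clustering, i.e. IR-flavoured (S2's caveat) — it is NOT
part of the UV ask. -/
def CovEnvelopeAt : Prop :=
  ∃ W₀ β₀ : ℝ, ∀ β : ℝ, β₀ ≤ β → ∀ᶠ L : ℕ in atTop, ∀ x ∈ box 4 L, ∀ y ∈ box 4 L,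
    ‖x - y‖ ≤ (L : ℝ) →
      |torusE G r β L (fun U => dens G r x U * dens G r y U) -
          torusE G r β L (dens G r x) * torusE G r β L (dens G r y)| ≤ W₀ / (1 + ‖x - y‖) ^ 8

/-- **AF WINDOW at scale `ℓ` (leg-1 ∕ UV-desk node candidate «N29»).**  For every tolerance `W > 0` a factor `T′(W)` such that,
for all large `β` and all large odd tori, `(1+‖x−y‖)⁸ |Cov_{β,L}(A_x, A_y)| ≤ W` whenever `T′‖x−y‖ ≤ ℓ(β)` — the hypothesis `haf`
of `AfPincerUc.afBelowScale_of_covarianceAF` verbatim.  Physically, with `ℓ = ℓ_AF(β)` a scale up to which the running coupling is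
small, this is «the dimensionless `tr F²` two-point function is as small as asymptotic freedom says, uniformly in `β`, at lattice
separations `≤ ℓ_AF(β)/T′`»; NON-VACUOUS at the polynomial scale `ℓ = (β/(1+log β))^{1/4}` unconditionally
(`AfPincerUc.covarianceAF_window_polyScale`); OPEN at any scale comparable to the onset.  The UV leg's present currency
(`Theses.BalabanUVNodes`: effective actions at the record) has no node stating a plaquette-covariance bound: this is the typed ask. -/
def CovWindowAt (ℓ : ℝ → ℝ) : Prop :=
  ∀ W : ℝ, 0 < W → ∃ T' β₀ : ℝ, 0 < T' ∧ ∀ β : ℝ, β₀ ≤ β → ∀ᶠ L : ℕ in atTop,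
    ∀ x ∈ box 4 L, ∀ y ∈ box 4 L, ‖x - y‖ ≤ (L : ℝ) → T' * ‖x - y‖ ≤ ℓ β →
      |torusE G r β L (fun U => dens G r x U * dens G r y U) -
          torusE G r β L (dens G r x) * torusE G r β L (dens G r y)| ≤ W / (1 + ‖x - y‖) ^ 8

variable {G r}

/-- The window is ANTITONE in the scale: a window up to `ℓ` is a window up to any eventually smaller `ℓ′`. [arithmetic] -/
theorem covWindowAt_anti {ℓ ℓ' : ℝ → ℝ} (h : CovWindowAt G r ℓ) (hle : ∃ β₃ : ℝ, ∀ β : ℝ, β₃ ≤ β → ℓ' β ≤ ℓ β) :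
    CovWindowAt G r ℓ' := by
  intro W hW
  obtain ⟨T', β₀, hT', hβ⟩ := h W hW
  obtain ⟨β₃, hβ₃⟩ := hle
  refine ⟨T', max β₀ β₃, hT', fun β hb => ?_⟩
  have hβ0 : β₀ ≤ β := le_trans (le_max_left _ _) hb
  have hβ3 : β₃ ≤ β := le_trans (le_max_right _ _) hb
  filter_upwards [hβ β hβ0] with L hL x hx y hy hxy hT
  exact hL x hx y hy hxy (hT.trans (hβ₃ β hβ3))

/-- The window tolerates constant factors DOWNWARD: a window up to `ℓ` is a window up to `c·ℓ` for `c ≤ 1`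
(`c ℓ ≤ ℓ` needs `0 ≤ ℓ` eventually, which we ask). [arithmetic] -/
theorem covWindowAt_const_mul {ℓ : ℝ → ℝ} (h : CovWindowAt G r ℓ) {c : ℝ} (hc1 : c ≤ 1)
    (hℓ : ∃ β₃ : ℝ, ∀ β : ℝ, β₃ ≤ β → 0 ≤ ℓ β) : CovWindowAt G r (fun β => c * ℓ β) := by
  refine covWindowAt_anti h ?_
  obtain ⟨β₃, hβ₃⟩ := hℓ
  refine ⟨β₃, fun β hβ => ?_⟩
  have h0 := hβ₃ β hβ
  nlinarith

end XSide

/-! ## §2 The I side of lane (1)A: the typical format at a mesh `≤ B(δ)·ℓ(β)` -/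
section ISide

variable {G : Type} [Group G] [TopologicalSpace G] [IsTopologicalGroup G] [CompactSpace G]
  [MeasurableSpace G] [BorelSpace G]

/-- **FORMAT AT SCALE `ℓ`** (the I-side target of lane (1)A at `(ρ, n, ε)`): for every rarity budget `δ > 0` a factor `B(δ) > 0`
such that for all large `β` the typical format `TypShellCondUKPc ρ β b n ε δ` holds at SOME mesh `1 ≤ b ≤ B(δ)·ℓ(β)` — S2 g2's
hypothesis `hF` verbatim (the LEAD's mixing theorem in sharp form, OPEN: typical mixing at a mesh comparable to `ℓ`). -/
def TypFormatAtScaleAt {N : ℕ} (ρ : G →* Matrix (Fin N) (Fin N) ℂ) (n : ℕ) (ε : ℝ) (ℓ : ℝ → ℝ) : Prop :=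
  ∀ δ : ℝ, 0 < δ → ∃ B β₂ : ℝ, 0 < B ∧ ∀ β : ℝ, β₂ ≤ β →
    ∃ b : ℕ, 1 ≤ b ∧ (b : ℝ) ≤ B * ℓ β ∧ TypShellCondUKPc ρ β b n ε δ

/-- Format-at-scale is MONOTONE in the scale up to constants: `ℓ ≤ C·ℓ′` eventually (`C > 0`) transports it from `ℓ` to `ℓ′`
(`B ↦ B·C`). [arithmetic] -/
theorem typFormatAtScaleAt_mono {N : ℕ} {ρ : G →* Matrix (Fin N) (Fin N) ℂ} {n : ℕ} {ε : ℝ} {ℓ ℓ' : ℝ → ℝ}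
    (h : TypFormatAtScaleAt ρ n ε ℓ) {C : ℝ} (hC : 0 < C) (hle : ∃ β₃ : ℝ, ∀ β : ℝ, β₃ ≤ β → ℓ β ≤ C * ℓ' β) :
    TypFormatAtScaleAt ρ n ε ℓ' := by
  intro δ hδ
  obtain ⟨B, β₂, hB, hβ⟩ := h δ hδ
  obtain ⟨β₃, hβ₃⟩ := hle
  refine ⟨B * C, max β₂ β₃, mul_pos hB hC, fun β hb => ?_⟩
  obtain ⟨b, hb1, hbℓ, hP⟩ := hβ β (le_trans (le_max_left _ _) hb)
  refine ⟨b, hb1, hbℓ.trans ?_, hP⟩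
  have := hβ₃ β (le_trans (le_max_right _ _) hb)
  calc B * ℓ β ≤ B * (C * ℓ' β) := mul_le_mul_of_nonneg_left this hB.le
    _ = B * C * ℓ' β := by ring

end ISide

/-! ## §3 The lane (1)A contract on the simply connected family and the glue BY NAME to I♯_SC and to the route decl -/

/-- **Lane (1)A contract (SC family).**  For every simply connected compact simple `G` and every lattice representation `r`:
ONE admissible `(n, ε)` and ONE scale `ℓ` carrying the I-side format-at-scale (§2), the ENVELOPE and the AF WINDOW at `ℓ` (§1).
No unit map, no `LowerBounds` among the binders: the NT unit enters only in the glue (§4's pin). -/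
def LaneAContractSC : Prop :=
  ∀ (G : Type) [Group G] [TopologicalSpace G] [IsTopologicalGroup G] [CompactSpace G],
    IsCompactSimpleLieGroup G → SimplyConnectedSpace G →
    letI : MeasurableSpace G := borel G; haveI : BorelSpace G := ⟨rfl⟩;
    ∀ r : LatticeRep G, ∃ (n : ℕ) (ε : ℝ), 1 ≤ n ∧ 0 ≤ ε ∧ ε * OnsetFormats.shellCount n ≤ 3 / 4 ∧
      ∃ ℓ : ℝ → ℝ, TypFormatAtScaleAt r.ρ n ε ℓ ∧ CovEnvelopeAt G r ∧ CovWindowAt G r ℓ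

/-- **Lane (1)A contract ⇒ I♯_SC BY NAME (PROVED)** — S2 g2's `onsetSharpUKPcSC_of_formatAtScale_covarianceAF`, hypotheses
now named. [kernel composition; hypotheses OPEN] -/
theorem onsetSharpUKPcSC_of_laneAContractSC (h : LaneAContractSC) : SharpOnset.OnsetSharpUKPcSC := by
  refine onsetSharpUKPcSC_of_formatAtScale_covarianceAF fun G _ _ _ _ hG hsc => ?_
  letI : MeasurableSpace G := borel G
  haveI : BorelSpace G := ⟨rfl⟩
  intro r
  obtain ⟨n, ε, hn, hε, hM, ℓ, hF, henv, haf⟩ := h G hG hsc r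
  exact ⟨n, ε, hn, hε, hM, ℓ, hF, henv, haf⟩

/-- **Lane (1)A contract ∧ residual ⇒ `BalabanLadder.IR` BY NAME (PROVED, E discharged by p524017, no X-stub).** -/
theorem ir_of_laneAContractSC (h : LaneAContractSC) (hN : SharpOnset.IRNSC) :
    Summit.QuantumFields.YangMills.Theses.BalabanLadder.IR :=
  SharpOnset.ir_of_onsetSharpSC (onsetSharpUKPcSC_of_laneAContractSC h) hN

/-! ## §4 The pin BY NAME: envelope ∧ window force the scale below `T₀ / a(β)` for every NT unit -/
section Pin

variable {G : Type} [Group G] [TopologicalSpace G] [IsTopologicalGroup G] [CompactSpace G]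
  [MeasurableSpace G] [BorelSpace G]

/-- **THE PIN (PROVED; S2's `afBelowScale_of_covarianceAF` + `scale_pinned_of_witness`).**  ENVELOPE ∧ WINDOW at `ℓ` and a positive
unit `a` carrying `LowerBounds G r a` give `T₀, β₁` with `a(β)·ℓ(β) < T₀` for all `β ≥ β₁`: the asymptotic-freedom scale is `O(1/a)` in
lattice units — «X′ for free» in the owner's words.  (Only clause (i) of `LowerBounds` is used.) -/
theorem mul_scale_lt_of_covWindow (r : LatticeRep G) (a ℓ : ℝ → ℝ) (ha : ∀ β, 0 < a β)
    (henv : CovEnvelopeAt G r) (haf : CovWindowAt G r ℓ) (hlb : LowerBounds G r a) :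
    ∃ T₀ β₁ : ℝ, ∀ β : ℝ, β₁ ≤ β → a β * ℓ β < T₀ := by
  obtain ⟨⟨v, ε₅, β₅, Λ₅, hv, hε₅, hlow⟩, -⟩ := hlb
  obtain ⟨T, β₁, hT⟩ := afBelowScale_of_covarianceAF r ℓ henv haf v hv (half_pos hε₅)
  exact ⟨T, max β₁ β₅, scale_pinned_of_witness r a ℓ ha hlow hT hε₅⟩

/-- Corollary of the pin: under ENVELOPE ∧ WINDOW(ℓ), format-at-scale `ℓ` implies format-at-scale `1/a` for every NT unit `a`
(`typFormatAtScaleAt_mono` with `ℓ ≤ T₀ · (1/a)` eventually). -/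
theorem typFormatAtScaleAt_inv_of_covWindow (r : LatticeRep G) (a ℓ : ℝ → ℝ) (ha : ∀ β, 0 < a β)
    (henv : CovEnvelopeAt G r) (haf : CovWindowAt G r ℓ) (hlb : LowerBounds G r a) {n : ℕ} {ε : ℝ}
    (hF : TypFormatAtScaleAt r.ρ n ε ℓ) : TypFormatAtScaleAt r.ρ n ε (fun β => 1 / a β) := by
  obtain ⟨T₀, β₁, hT⟩ := mul_scale_lt_of_covWindow r a ℓ ha henv haf hlb
  refine typFormatAtScaleAt_mono hF (lt_max_of_lt_right one_pos : (0 : ℝ) < max T₀ 1) ⟨β₁, fun β hβ => ?_⟩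
  have h1 := hT β hβ
  have ha' := ha β
  rw [mul_one_div, le_div_iff₀ ha']
  calc ℓ β * a β = a β * ℓ β := mul_comm _ _
    _ ≤ T₀ := h1.le
    _ ≤ max T₀ 1 := le_max_left _ _

end Pin

/-! ## §5 Located strength comparison: at the NT unit, format-at-scale IS I♯ -/
section Strength

variable {G : Type} [Group G] [TopologicalSpace G] [IsTopologicalGroup G] [CompactSpace G]
  [MeasurableSpace G] [BorelSpace G]

/-- **Pointwise: the I♯ clause at `(ρ, a, n, ε)` ⟺ format at scale `1/a` (PROVED, arithmetic both ways).**  The I♯ clause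
«`∀ δ > 0 ∃ T β₂ ∀ β ≥ β₂ ∃ b ≥ 1, a β · b < T ∧ format`» and «`∀ δ > 0 ∃ B > 0, β₂ ∀ β ≥ β₂ ∃ b ≥ 1, b ≤ B/a(β) ∧ format`»
are the same statement up to `T ↦ B := T`, `B ↦ T := B + 1`. -/
theorem onsetSharpAt_iff_typFormatAtScaleAt_inv {N : ℕ} (ρ : G →* Matrix (Fin N) (Fin N) ℂ) (a : ℝ → ℝ)
    (ha : ∀ β, 0 < a β) (n : ℕ) (ε : ℝ) :
    (∀ δ : ℝ, 0 < δ → ∃ T β₂ : ℝ, ∀ β : ℝ, β₂ ≤ β →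
        ∃ b : ℕ, 1 ≤ b ∧ a β * (b : ℝ) < T ∧ TypShellCondUKPc ρ β b n ε δ) ↔
      TypFormatAtScaleAt ρ n ε (fun β => 1 / a β) := by
  constructor
  · intro h δ hδ
    obtain ⟨T, β₂, hβ⟩ := h δ hδ
    -- `T > 0` since `a β₂ * b < T` with `b ≥ 1`
    obtain ⟨b₀, hb₀, hlt₀, -⟩ := hβ β₂ le_rfl
    have hT : 0 < T := lt_of_le_of_lt (mul_nonneg (ha β₂).le (Nat.cast_nonneg _)) hlt₀
    refine ⟨T, β₂, hT, fun β hb => ?_⟩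
    obtain ⟨b, hb1, hlt, hP⟩ := hβ β hb
    refine ⟨b, hb1, ?_, hP⟩
    rw [mul_one_div, le_div_iff₀ (ha β)]
    calc (b : ℝ) * a β = a β * (b : ℝ) := mul_comm _ _
      _ ≤ T := hlt.le
  · intro h δ hδ
    obtain ⟨B, β₂, hB, hβ⟩ := h δ hδ
    refine ⟨B + 1, β₂, fun β hb => ?_⟩
    obtain ⟨b, hb1, hle, hP⟩ := hβ β hb
    refine ⟨b, hb1, ?_, hP⟩
    rw [mul_one_div, le_div_iff₀ (ha β)] at hle
    calc a β * (b : ℝ) = (b : ℝ) * a β := mul_comm _ _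
      _ ≤ B := hle
      _ < B + 1 := lt_add_one B

/-- **I♯_SC restated through format-at-scale at the NT unit.**  On the simply connected family, for every `(G, r)` and every positive
unit `a → 0` carrying `LowerBounds G r a`: admissible `(n, ε)` with format at scale `1/a`. -/
def FormatAtInvUnitSC : Prop :=
  ∀ (G : Type) [Group G] [TopologicalSpace G] [IsTopologicalGroup G] [CompactSpace G],
    IsCompactSimpleLieGroup G → SimplyConnectedSpace G →
    letI : MeasurableSpace G := borel G; haveI : BorelSpace G := ⟨rfl⟩;
    ∀ (r : LatticeRep G) (a : ℝ → ℝ), (∀ β, 0 < a β) → Tendsto a atTop (𝓝 0) → LowerBounds G r a →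
      ∃ (n : ℕ) (ε : ℝ), 1 ≤ n ∧ 0 ≤ ε ∧ ε * OnsetFormats.shellCount n ≤ 3 / 4 ∧
        TypFormatAtScaleAt r.ρ n ε (fun β => 1 / a β)

/-- **I♯_SC ⟺ format at the NT unit's own scale (PROVED).**  What lane (1)A therefore buys is exactly the PIN (§4: the I-side may
work at the UV scale `ℓ_AF ≤ T₀/a` instead of `1/a`) and the relocation of the X-side to the UV desk (WINDOW); it does not lighten the
I-side, and `TypFormatAtScaleAt … ℓ_AF` is stronger than the I♯ clause at `(G, r, a)` unless `ℓ_AF ≳ 1/a` as well. -/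
theorem onsetSharpUKPcSC_iff_formatAtInvUnitSC : SharpOnset.OnsetSharpUKPcSC ↔ FormatAtInvUnitSC := by
  constructor
  · intro h G _ _ _ _ hG hsc
    letI : MeasurableSpace G := borel G
    haveI : BorelSpace G := ⟨rfl⟩
    intro r a ha hat hlb
    obtain ⟨n, ε, hn, hε, hM, hδ⟩ := h G hG hsc r a ha hat hlb
    exact ⟨n, ε, hn, hε, hM, (onsetSharpAt_iff_typFormatAtScaleAt_inv r.ρ a ha n ε).mp hδ⟩
  · intro h G _ _ _ _ hG hsc
    letI : MeasurableSpace G := borel G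
    haveI : BorelSpace G := ⟨rfl⟩
    intro r a ha hat hlb
    obtain ⟨n, ε, hn, hε, hM, hF⟩ := h G hG hsc r a ha hat hlb
    exact ⟨n, ε, hn, hε, hM, (onsetSharpAt_iff_typFormatAtScaleAt_inv r.ρ a ha n ε).mpr hF⟩

/-- **The lane's I-side content isolated (PROVED):** ENVELOPE ∧ WINDOW(ℓ) ∧ format-at-scale(ℓ) at `(G, r)` on the simply connected family
give the I♯ clause at every NT unit `a` of that `(G, r)` — pointwise form of §3, through §4's pin and §5's equivalence (no appeal to S2 §7;
the two routes agree). -/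
theorem onsetSharp_clause_of_laneA (r : LatticeRep G) (a ℓ : ℝ → ℝ) (ha : ∀ β, 0 < a β)
    (henv : CovEnvelopeAt G r) (haf : CovWindowAt G r ℓ) (hlb : LowerBounds G r a) {n : ℕ} {ε : ℝ}
    (hF : TypFormatAtScaleAt r.ρ n ε ℓ) :
    ∀ δ : ℝ, 0 < δ → ∃ T β₂ : ℝ, ∀ β : ℝ, β₂ ≤ β →
      ∃ b : ℕ, 1 ≤ b ∧ a β * (b : ℝ) < T ∧ TypShellCondUKPc r.ρ β b n ε δ :=
  (onsetSharpAt_iff_typFormatAtScaleAt_inv r.ρ a ha n ε).mpr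
    (typFormatAtScaleAt_inv_of_covWindow r a ℓ ha henv haf hlb hF)

end Strength

end Summit.QuantumFields.YangMills.Cruxes.IR.AfPincerUc.SharpLanes

end
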